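import Summits.Ventures.PercRepro2.CaseOneStarCertT1
import Summits.Ventures.PercRepro2.CaseOneGadgetUWA1BBlockIQ0
import Summits.Ventures.PercRepro2.CaseOneGadgetUWA1BBlockIQ1
import Summits.Ventures.PercRepro2.CaseOneGadgetUWA1BBlockIQ2
import Summits.Ventures.PercRepro2.CaseOneGadgetUWA1BBlockIQ3
import Summits.Ventures.PercRepro2.CaseOneGadgetUWA1BBlockIQ4
import Summits.Ventures.PercRepro2.CaseOneGadgetUWA1BBlockIQ5
import Summits.Ventures.PercRepro2.CaseOneGadgetUWA1BBlockIQ6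
import Summits.Ventures.PercRepro2.CaseOneGadgetUWA1BBlockIQ7R
import Summits.Ventures.PercRepro2.CaseOneGadgetUWA1BBlockIQ8
import Summits.Ventures.PercRepro2.CaseOneGadgetUWA1BBlockIQ9R
import Summits.Ventures.PercRepro2.CaseOneGadgetUWA1BBlockIQ10
import Summits.Ventures.PercRepro2.CaseOneGadgetUWA1BBlockIQ11
import Summits.Ventures.PercRepro2.CaseOneGadgetUWA1BBlockIQ12
import Summits.Ventures.PercRepro2.CaseOneGadgetUWA1BBlockIQ13
import Summits.Ventures.PercRepro2.CaseOneGadgetUWA1BBlockIQ14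

/-!
# The gadget `u ~ {w, a₁, b}`, `w ~ {u, a₂, o}` (uwa1b): the cell certificates of `iqAB5` (part 75a)
(blind cell PercRepro2, p1 g34; the fourth gadget anchor of the six-form calculus — all six forms of the uwa1b gadget
as plain SFacts-cone certificate chains, generated by mining/p1/g34/uwa1b/genu.py = p1 g33's gent_uwa1.py / g25's
geno.py re-targeted; P1-G33 §6–§6″, P1-G34)

Each `eBABIQ ijk kl` is a nonnegative combination of `(pairwise atom) × (cell)` and cubic cell monomials — or, for the degree-4 ones, `M × eBABIQ ijk kl` (`M = Σ cᵢ` the total cell mass) is a nonnegative combination of `(atom) × (cell) × (cell)` and quartic cell monomials, then `SFacts.nonneg_of_sum_mul` (`CaseOneStarCertT1`) — exact LP certificates (kit j319447, every certificate re-verified exactly; data/p1/g33/gcerts_i_uwa1b.json, form `i-Q`), here as exact `linear_combination`s over `SFacts` (the rational coefficients cleared by their common denominator). -/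

namespace Summit.Ventures.PercRepro2

namespace CaseOne

section CertABIQ75a
variable {R : Type*} [Field R] [LinearOrder R] [IsStrictOrderedRing R]

set_option maxHeartbeats 0 in
/-- `eBABIQ33212 ≥ 0`: the combination is identically zero (`ring`). -/
lemma eBABIQ33212_nonneg (m : SCells R) (_hf : SFacts m) : 0 ≤ eBABIQ33212 m := by
  have h : eBABIQ33212 m = 0 := by
    unfold eBABIQ33212 cBABIQ00112 cBABIQ01012 cBABIQ01112 cBABIQ01212 cBABIQ02112 cBABIQ02212 cBABIQ03212 cBABIQ10012 cBABIQ10112 cBABIQ10212 cBABIQ11012 cBABIQ11112 cBABIQ11212 cBABIQ12012 cBABIQ12112 cBABIQ12212 cBABIQ13112 cBABIQ13212 cBABIQ20112 cBABIQ20212 cBABIQ21012 cBABIQ21112 cBABIQ21212 cBABIQ22012 cBABIQ22112 cBABIQ22212 cBABIQ23012 cBABIQ23112 cBABIQ23212 cBABIQ30212 cBABIQ31112 cBABIQ31212 cBABIQ32012 cBABIQ32112 cBABIQ32212 cBABIQ33012 cBABIQ33112 cBABIQ33212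
    ring
  linarith [h]

end CertABIQ75a

end CaseOne

end Summit.Ventures.PercRepro2
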